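import Summits.RiemannHypothesis.RiemannHypothesis.Theorems.HandoffDodgerExplicitWindowCounting
import Summits.RiemannHypothesis.RiemannHypothesis.Theorems.HandoffDodgerRateSevenHorizon
import Summits.RiemannHypothesis.RiemannHypothesis.Theorems.HandoffDodgerRateSevenProfile
import Summits.RiemannHypothesis.RiemannHypothesis.Theorems.HandoffDodgerRateSevenWindow
import Summits.RiemannHypothesis.RiemannHypothesis.Theorems.HandoffDodgerRateSevenCost
import Summits.RiemannHypothesis.RiemannHypothesis.Theorems.HandoffDodgerRateSevenPhi
import Summits.RiemannHypothesis.RiemannHypothesis.Theorems.HandoffDodgerSmallCeiling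
import HarnessLib

/-!
# HANDOFF — RATE 7/100 FROM 10⁴ (6): THE RH-FREE ZERO-SUM FAMILY `SubwindowZeroSumFamily (7/100) 10000` AND THE WALL CEILING FROM 10⁴ (rh-explicit, W-P(P1)/(P2) item 19394 `DodgerFamilyFromTenThousand`, seat dodger-p2 gen2)

RH-FREE. HONEST FRAMING: nothing here bears on the truth of RH; every statement is an UPPER-side ingredient — the zero-sum clause of the
mollified zero-dodger and the wall CEILING `δ*(q) ≤ (7/100)(log q)^{3/2}q^{−3/2}` (RH is the LOWER clause `∀ q, 0 ≤ δ*(q)`, not touched).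

The threshold-free theorem `HandoffDodgerExplicitWindowCounting.dodger_witness_explicit_window_counting` (explicit dodger witness with a free
collar window AND ATTEMPT-16's COUNTING profile control) is assembled at the UNIFORM schedule `y = (23/25)L^{3/2}`, `N₁ = ⌈(16/5)L⌉`,
`α = 12/25`, `n = q³`, at the PRINTED rate `C = 7/100`, `b = L/2 − ε`, whose hypotheses hold for EVERY `L = log q ≥ log 10⁴` by parts (1)–(5)
(`HandoffDodgerRateSeven{Horizon,Profile,Window,Cost,Phi}`; design check HOME/rh-explicit-dodger-p2 gen2 code/design7.py, exact audit
code/model5.py: gain/cost ≥ 13 at 10⁴ and super-exponentially increasing):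
* **`subwindowZeroSumFamily_tenThousand : SubwindowZeroSumFamily (7/100) 10000`** — the statement of the WEIL route's item
  `DodgerFamilyFromTenThousand` (stmt-RiemannHypothesis-19394; the tree had it from `⌈e^{204}⌉` at rate 7/100, gen10, and from `60000` at
  rate 1/5, gen11);
* `dodgerWallCeiling_tenThousand : DodgerWallCeiling (7/100) 10000` — `δ*(q) ≤ (7/100)(log q)^{3/2}q^{−3/2}` for EVERY prime `q ≥ 10⁴`.
No `sorry`, standard axioms; every ingredient is a theorem of this track or of Mathlib.

References: this track (ATTEMPT-16 THEOREMS 16.1–16.2, ATTEMPT-19 §7–§8, ATTEMPT-21 §7, ATTEMPT-23 §7; HOME/rh-explicit-dodger-p2/DODGER-STAGE2-PLAN.md).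
-/

set_option linter.dupNamespace false

noncomputable section

open Real Complex Set MeasureTheory Literature.NumberTheory.LFunctions Literature.NumberTheory.LFunctions.WeilContinuous

namespace Summit.RiemannHypothesis.RiemannHypothesis.Theorems.Handoff

open Summit.RiemannHypothesis.RiemannHypothesis.Theorems.MotivicDoor.SemilocalThreshold

set_option maxHeartbeats 800000 in
/-- **THEOREM (the RH-free zero-sum family at the PRINTED rate `(7/100)(log q)^{3/2}q^{−3/2}` from `q₀ = 10⁴` on)** — the uniform counting-window
chain of parts (1)–(5). [this track, ATTEMPT-16 THEOREM 16.2; ATTEMPT-23 §7; DODGER-STAGE2-PLAN] -/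
theorem subwindowZeroSumFamily_tenThousand : SubwindowZeroSumFamily (7 / 100) 10000 := by
  intro q q' hqq' hq₀
  obtain ⟨hqprime, -, hqq, -⟩ := hqq'
  have hq2 : 2 ≤ q := hqprime.two_le
  have hq0 : (0 : ℝ) < q := by exact_mod_cast hqprime.pos
  -- the mollifier radius `r = 1/(q³+1)`, a generic `ε ∈ [r, 2r]`, the half-width `b = L/2 − ε`
  have hr : (bump (q ^ 3)).rOut = 1 / ((q : ℝ) ^ 3 + 1) := by rw [bump_rOut]; push_cast; ring
  have hr0 : 0 < (bump (q ^ 3)).rOut := (bump (q ^ 3)).rOut_pos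
  obtain ⟨ε, ⟨hε1, hε2⟩, hgen⟩ := exists_generic_shift (Real.log q) hr0
  set b : ℝ := Real.log q / 2 - ε with hb
  have hbq1 : b + (bump (q ^ 3)).rOut ≤ Real.log q / 2 := by linarith
  have hbq2 : Real.log q / 2 ≤ b + 2 * (bump (q ^ 3)).rOut := by linarith
  -- part (3), radius: `23/5 ≤ b`, `2b ≤ L ≤ 2b + 1/100`, `9.21 ≤ L`
  obtain ⟨-, -, -, hL9, -, hb46, hL1, hL2, -⟩ := radius_facts_seven hq₀ rfl hr hbq1 hbq2
  have hb1 : 1 ≤ b := by linarith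
  have hL0 : 0 < Real.log q := by linarith
  have hy0 : 0 < 23 / 25 * (Real.log q * Real.sqrt (Real.log q)) := mul_pos (by norm_num) (mul_pos hL0 (Real.sqrt_pos.2 hL0))
  -- part (1): the horizon
  obtain ⟨hside1, hside2⟩ := seven_horizon_side_conditions hb46
  obtain ⟨hA, hB, hT3, hk2, hℓ2, hK1, -⟩ := seven_horizon_index_bounds hb46
  obtain ⟨h101, hT'T₀, -, hTbig, hcI, -, hcI3, hcL, hpL, hpU0, hpU, hW1, -, -, hk2', hk04, hk04', hTe, hT79, hT36⟩ :=
    seven_horizon_sizes_B hb46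
  have hTT₀ : π * (dodgerKprime b : ℝ) / b ≤ 2 * π * Real.exp (1 + 2 * b) := hT'T₀
  have hTe' : 17.06 * Real.exp (2 * b) ≤ π * (dodgerKprime b : ℝ) / b := hTe
  have hp : 0 < dodgerPL b := lt_of_lt_of_le (by have := Real.pi_pos; positivity) hpL
  -- part (3): the window conditions at rate `7/100`
  obtain ⟨-, ⟨hδU0, hδU1, hδb⟩, ⟨hr600, -⟩, hδC, hwin, ⟨hQ0, hQ⟩, -⟩ :=
    window_conditions_seven (T := π * (dodgerKprime b : ℝ) / b) (pL := dodgerPL b) (pU := dodgerPU b)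
      (y := 23 / 25 * (Real.log q * Real.sqrt (Real.log q))) hq₀ rfl hr hbq1 hbq2 hTe' hTT₀ hpL hpU0 hpU rfl rfl rfl
  -- the schedule `N₁ = ⌈(16/5)L⌉` against the horizon: `180N₁² ≤ T′`, `5480N₁ ≤ T′`, `18000L ≤ T′`
  have hN₁le : ((⌈16 / 5 * Real.log q⌉₊ : ℕ) : ℝ) ≤ 16 / 5 * Real.log q + 1 :=
    (Nat.ceil_lt_add_one (show 0 ≤ 16 / 5 * Real.log q by positivity)).le
  have hN0 : (0 : ℝ) ≤ ((⌈16 / 5 * Real.log q⌉₊ : ℕ) : ℝ) := Nat.cast_nonneg _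
  have hN₁b : ((⌈16 / 5 * Real.log q⌉₊ : ℕ) : ℝ) ≤ 6.4 * b + 1.04 := by linarith only [hN₁le, hL2]
  obtain ⟨-, -, -, -, hdomN2, hdomL⟩ := exp_two_mul_bounds_seven hb46
  have hdomN1 := exp_dominates_N_seven hb46
  have hTN : 180 * ((⌈16 / 5 * Real.log q⌉₊ : ℕ) : ℝ) ^ 2 ≤ π * (dodgerKprime b : ℝ) / b := by
    have : ((⌈16 / 5 * Real.log q⌉₊ : ℕ) : ℝ) ^ 2 ≤ (6.4 * b + 1.04) ^ 2 := pow_le_pow_left₀ hN0 hN₁b 2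
    linarith only [this, hdomN2, hTe']
  have hTN1 : 5480 * ((⌈16 / 5 * Real.log q⌉₊ : ℕ) : ℝ) ≤ π * (dodgerKprime b : ℝ) / b := by
    linarith only [hN₁b, hdomN1, hTe']
  have hTL : 18000 * Real.log q ≤ π * (dodgerKprime b : ℝ) / b := by linarith only [hL2, hdomL, hTe']
  -- part (2): the COUNTING profile-control constants, `κ ≥ 0.938`
  obtain ⟨hT₀e, -, -, -, -, -, hs9, hsb⟩ := seven_horizon_sizes hb46
  have hT₀pos : 0 < dodgerT₀ b := lt_of_lt_of_le (Real.exp_pos 1) hT₀e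
  have hs0 : (0 : ℝ) ≤ (0.1038 * Real.log (dodgerT₀ b) + 0.2573 * Real.log (Real.log (dodgerT₀ b)) + 9.3675) := by
    linarith only [hs9]
  obtain ⟨hN, hρ11, hρ2e, hκ⟩ :=
    profile_constants_seven (T := π * (dodgerKprime b : ℝ) / b) (T₀ := dodgerT₀ b) (k := (dodgerKprime b : ℝ)) (pL := dodgerPL b)
      (W := dodgerW b) (y := 23 / 25 * (Real.log q * Real.sqrt (Real.log q))) (N₁ := ⌈16 / 5 * Real.log q⌉₊) (V := dodgerT₀ b ^ 2)
      (AU := dodgerT₀ b / (25 * π) + (0.1038 * Real.log (dodgerT₀ b) + 0.2573 * Real.log (Real.log (dodgerT₀ b)) + 9.3675) / 2 +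
        (π * (dodgerKprime b : ℝ) / b + 1 / 4) * (dodgerKprime b : ℝ) / dodgerW b)
      hb46 hL1 hTbig hT₀pos h101 hT36 hTN hTN1 hTL hW1 hk2' hk04' hpL hs0 hsb rfl rfl rfl rfl rfl rfl rfl rfl rfl rfl rfl
  -- part (5): the profile value, `527000(b+1.17)e^{2b} < Φ²` ⇒ `463000(b+1.17)e^{2b} < 0.938²·Φ²`
  have hval0 := profile_value_seven hb46 hL1 (rfl : 23 / 25 * (Real.log q * Real.sqrt (Real.log q)) = _)
    (hasSum_dodgerPhi ((199 * (12 / 25 : ℝ) / 100) ^ 2 * (23 / 25 * (Real.log q * Real.sqrt (Real.log q))) ^ 2))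
  have hval : 463000 * (b + 1.17) * Real.exp (2 * b) <
      (0.938 : ℝ) ^ 2 * dodgerPhi ((199 * (12 / 25 : ℝ) / 100) ^ 2 * (23 / 25 * (Real.log q * Real.sqrt (Real.log q))) ^ 2) ^ 2 := by
    have hpos : 0 < (b + 1.17) * Real.exp (2 * b) := by positivity
    nlinarith only [hval0, hpos]
  -- part (4): the comparison
  have hΦ0 := (dodgerPhi_pos (show (0 : ℝ) ≤ (199 * (12 / 25 : ℝ) / 100) ^ 2 * (23 / 25 * (Real.log q * Real.sqrt (Real.log q))) ^ 2
    by positivity)).le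
  have hlt := cost_lt_gain_seven (cI := dodgerCI b) (r := (bump (q ^ 3)).rOut) (L := Real.log q) (Q := Real.sqrt q)
    (κ₀ := 0.938) hb46 hL1 hTe' hTbig hT79 hTT₀ hk2' hk04 hcI hcI3 rfl rfl hδU0 hδU1 hQ0 hQ (by norm_num) hκ hr600 rfl rfl hpU0 hpU
    hΦ0 le_rfl hval
  -- the genericity of the lattice
  have hgen' : ∀ ρ : ℂ, riemannZeta ρ = 0 → 0 < ρ.im →
      ∀ k ∈ Finset.range (zetaZeroCount (π * (dodgerKprime b : ℝ) / b)), dodgerNode ρ - latticeFreq b (k + 1) ≠ 0 := by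
    intro ρ hζ hρ k _
    have h := hgen ρ hζ hρ.ne' k
    rw [sub_ne_zero]
    simpa [dodgerNode, latticeFreq] using h
  -- the explicit COUNTING dodger with the window `α = 12/25` at rate `C = 7/100`
  exact dodger_witness_explicit_window_counting (q := q) (q' := q') (b := b) (T₀ := dodgerT₀ b)
    (y := 23 / 25 * (Real.log q * Real.sqrt (Real.log q))) (C := 7 / 100) (α := 12 / 25) (n := q ^ 3) (k' := dodgerKprime b)
    (N₁ := ⌈16 / 5 * Real.log q⌉₊) (by norm_num) (by norm_num) hb1 rfl hside1 hside2 hA hB hT3 hk2 hℓ2 hK1 rfl rfl rfl rfl rfl rfl hy0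
    rfl rfl rfl rfl rfl rfl rfl rfl rfl rfl rfl hcL hp hN hρ11 hρ2e (le_trans (by norm_num) hκ) hδb hr600 hδC (hwin q' (by omega)) hbq1 hbq2
    hgen' hlt

/-- **COROLLARY (the Dodger wall ceiling from `10⁴` at the printed rate, RH-free).** `∀ primes q ≥ 10⁴, δ*(q) ≤ (7/100)(log q)^{3/2} q^{−3/2}`.
[this track, ATTEMPT-16 THEOREM 16.2; DODGER-STAGE2-PLAN] -/
theorem dodgerWallCeiling_tenThousand : DodgerWallCeiling (7 / 100) 10000 :=
  dodgerWallCeiling_of_zeroSumFamily subwindowZeroSumFamily_tenThousand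

end Summit.RiemannHypothesis.RiemannHypothesis.Theorems.Handoff

end
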